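import Literature.NumberTheory.GaloisRepresentations.MinimallyRamified
import Mathlib.LinearAlgebra.Matrix.ToLinearEquiv
import Mathlib.Algebra.Group.Subgroup.Finite
import HarnessLib

/-!
# Minimal ramification is independent of the frame (proofs only)

Companion of `MinimallyRamified.lean` (Diamond–Flach–Guo's predicate
`FramedGaloisRep.IsMinimallyRamifiedAtPrime 𝔓 ρ` for `ρ : Γ_K →ₜ* GL₂(A)`, `A` local).  Minimal
ramification is a property of the representation, not of the chosen basis: conjugating `ρ` by
`P ∈ GL₂(A)` (`FramedRep.conj`, FLT's `GaloisRep.conj`)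

* conjugates the reduction, `(P ρ P⁻¹)‾ = P̄ ρ̄ P̄⁻¹` (`FramedRep.reduction_conj_apply`), hence the
  inertia images (`map_reduction_conj`), which keep their `Nat.card`
  (`card_map_reduction_conj`) and their kernels (`reduction_conj_apply_eq_one_iff`);
* moves the inertia invariants `V^{I_𝔓} ⊆ (Frac A)ⁿ` by the linear automorphism `P ⊗ 1`
  (`FramedGaloisRep.inertiaInvariants_conj`, via the matrix identity
  `mulVec_conj_eq_self_iff : (Q M Q⁻¹) x = x ↔ M (Q⁻¹ x) = Q⁻¹ x`), preserving the dimension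
  (`finrank_inertiaInvariants_conj`, Mathlib `LinearEquiv.finrank_map_eq`);

so `IsMinimallyRamifiedAtPrime` and `IsMinimallyRamifiedAt` are invariant under change of frame
(`isMinimallyRamifiedAtPrime_conj_iff`, `isMinimallyRamifiedAt_conj_iff`), like
`FramedGaloisRep.isUnramifiedAt_conj_iff` of `GaloisRep.lean`.  Folklore linear algebra; no
definitions, no named facts.  Mathlib: `Matrix.toLinearEquiv'`, `Submodule.mem_map_equiv`,
`Subgroup.card_map_of_injective`, `MulAut.conj`.

## References

* F. Diamond, M. Flach, L. Guo, Ann. Sci. ÉNS 37 (2004), §3.1, p. 715 (the predicate; stated for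
  representations `G_ℚ → Aut_{K_ρ}(V_ρ)`, i.e. basis-free). [DiamondFlachGuo2004]
-/

noncomputable section

open scoped NumberField MatrixGroups
open Field IsDedekindDomain IsLocalRing

namespace Literature.NumberTheory.GaloisRepresentations

open scoped Matrix

universe u v

namespace FramedRep

variable {Γ : Type u} [Group Γ] [TopologicalSpace Γ] {A : Type v} [CommRing A] [IsLocalRing A]
  [TopologicalSpace A] [IsTopologicalRing A] {n : ℕ}

/-- The reduction of a conjugate is the conjugate of the reduction. [folklore] -/
theorem reduction_conj_apply (P : GL (Fin n) A) (ρ : FramedRep Γ A n) (σ : Γ) :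
    (ρ.conj P).reduction σ = Matrix.GeneralLinearGroup.map (residue A) P * ρ.reduction σ *
        (Matrix.GeneralLinearGroup.map (residue A) P)⁻¹ := by
  rw [reduction_apply, conj_apply, map_mul, map_mul, map_inv, reduction_apply]

/-- The image of a subgroup under the reduction of a conjugate is the conjugate subgroup. [folklore] -/
theorem map_reduction_conj (P : GL (Fin n) A) (ρ : FramedRep Γ A n) (H : Subgroup Γ) :
    H.map (ρ.conj P).reduction =
      (H.map ρ.reduction).map
        (MulAut.conj (Matrix.GeneralLinearGroup.map (residue A) P)).toMonoidHom := by
  rw [Subgroup.map_map]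
  congr 1
  ext σ : 1
  exact reduction_conj_apply P ρ σ

/-- `#ρ̄(H)` is invariant under change of frame. [folklore] -/
theorem card_map_reduction_conj (P : GL (Fin n) A) (ρ : FramedRep Γ A n) (H : Subgroup Γ) :
    Nat.card (H.map (ρ.conj P).reduction) = Nat.card (H.map ρ.reduction) := by
  rw [map_reduction_conj]
  exact Subgroup.card_map_of_injective (MulAut.conj _).injective

/-- `ρ̄ σ = 1` is invariant under change of frame. [folklore] -/
theorem reduction_conj_apply_eq_one_iff (P : GL (Fin n) A) (ρ : FramedRep Γ A n) (σ : Γ) :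
    (ρ.conj P).reduction σ = 1 ↔ ρ.reduction σ = 1 := by
  rw [reduction_conj_apply, mul_inv_eq_one, mul_eq_left]

end FramedRep

namespace FramedGaloisRep

variable {K : Type u} [Field K] {A : Type v} [CommRing A] [TopologicalSpace A]
  [IsTopologicalRing A] {n : ℕ}

/-- Matrix identity behind the change of frame on invariants: `(Q M Q⁻¹) x = x ↔ M (Q⁻¹ x) = Q⁻¹ x`.
[folklore] -/
theorem mulVec_conj_eq_self_iff {F : Type*} [CommRing F] (Q M : GL (Fin n) F) (x : Fin n → F) :
    ((Q * M * Q⁻¹ : GL (Fin n) F) : Matrix (Fin n) (Fin n) F) *ᵥ x = x ↔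
      (M : Matrix (Fin n) (Fin n) F) *ᵥ ((((Q⁻¹ : GL (Fin n) F)) : Matrix (Fin n) (Fin n) F) *ᵥ x) =
        ((Q⁻¹ : GL (Fin n) F) : Matrix (Fin n) (Fin n) F) *ᵥ x := by
  have hQ : ((Q⁻¹ : GL (Fin n) F) : Matrix (Fin n) (Fin n) F) * (Q : Matrix (Fin n) (Fin n) F) = 1 :=
    Units.inv_mul Q
  have hQ' : (Q : Matrix (Fin n) (Fin n) F) * ((Q⁻¹ : GL (Fin n) F) : Matrix (Fin n) (Fin n) F) = 1 :=
    Units.mul_inv Q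
  rw [Units.val_mul, Units.val_mul, Matrix.mulVec_mulVec]
  constructor
  · intro h
    have h2 := congrArg (fun y => ((Q⁻¹ : GL (Fin n) F) : Matrix (Fin n) (Fin n) F) *ᵥ y) h
    simp only [Matrix.mulVec_mulVec] at h2
    rwa [← mul_assoc, ← mul_assoc, hQ, one_mul] at h2
  · intro h
    have h2 := congrArg (fun y => (Q : Matrix (Fin n) (Fin n) F) *ᵥ y) h
    simp only [Matrix.mulVec_mulVec] at h2
    rwa [← mul_assoc, hQ', Matrix.one_mulVec] at h2

/-- The invariants of a conjugate `P ρ P⁻¹` are the image of the invariants of `ρ` under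
`Q = P ⊗ 1 ∈ GL_n(Frac A)`. [folklore] -/
theorem inertiaInvariants_conj (P : GL (Fin n) A) (ρ : FramedGaloisRep K A n)
    (𝔓 : Ideal (absIntegers (𝓞 K) K)) :
    FramedGaloisRep.inertiaInvariants 𝔓 (FramedRep.conj P ρ) =
      (ρ.inertiaInvariants 𝔓).map
        (((Matrix.GeneralLinearGroup.map (algebraMap A (FractionRing A)) P : GL (Fin n) (FractionRing A)) :
            Matrix (Fin n) (Fin n) (FractionRing A)).toLinearEquiv'
          (Units.invertible _)).toLinearMap := by
  set Q : GL (Fin n) (FractionRing A) := Matrix.GeneralLinearGroup.map (algebraMap A (FractionRing A)) P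
    with hQ
  ext x
  rw [Submodule.mem_map_equiv, mem_inertiaInvariants_iff, mem_inertiaInvariants_iff]
  have hsymm : ∀ y : Fin n → FractionRing A,
      ((Q : Matrix (Fin n) (Fin n) (FractionRing A)).toLinearEquiv' (Units.invertible _)).symm y =
        ((Q⁻¹ : GL (Fin n) (FractionRing A)) : Matrix (Fin n) (Fin n) (FractionRing A)) *ᵥ y := by
    intro y
    rw [← LinearEquiv.coe_coe, Matrix.toLinearEquiv'_symm_apply, Matrix.toLin'_apply, invOf_units]
  refine forall₂_congr fun σ _ => ?_
  rw [hsymm, FramedRep.conj_apply, map_mul, map_mul, map_inv]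
  exact mulVec_conj_eq_self_iff Q _ x

/-- `dim V^{I_𝔓}` is invariant under change of frame. [folklore] -/
theorem finrank_inertiaInvariants_conj (P : GL (Fin n) A) (ρ : FramedGaloisRep K A n)
    (𝔓 : Ideal (absIntegers (𝓞 K) K)) :
    Module.finrank (FractionRing A) (FramedGaloisRep.inertiaInvariants 𝔓 (FramedRep.conj P ρ)) =
      Module.finrank (FractionRing A) (ρ.inertiaInvariants 𝔓) := by
  rw [inertiaInvariants_conj]
  exact LinearEquiv.finrank_map_eq _ _

variable [IsLocalRing A]

/-- **Minimal ramification is invariant under change of frame** (it is a property of the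
representation, not of the chosen basis): all ingredients — `#ρ̄(I_𝔓)`, the kernels of `ρ̄|I` and
`ρ|I`, `dim V^{I_𝔓}` — are conjugation-invariant. [folklore] -/
theorem isMinimallyRamifiedAtPrime_conj_iff (P : GL (Fin 2) A) (ρ : FramedGaloisRep K A 2)
    (𝔓 : Ideal (absIntegers (𝓞 K) K)) :
    FramedGaloisRep.IsMinimallyRamifiedAtPrime 𝔓 (FramedRep.conj P ρ) ↔ ρ.IsMinimallyRamifiedAtPrime 𝔓 := by
  rw [isMinimallyRamifiedAtPrime_iff, isMinimallyRamifiedAtPrime_iff,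
    FramedRep.card_map_reduction_conj, finrank_inertiaInvariants_conj]
  refine and_congr (imp_congr_right fun _ => forall₂_congr fun σ _ => ?_) Iff.rfl
  rw [FramedRep.reduction_conj_apply_eq_one_iff, FramedRep.conj_apply, mul_inv_eq_one, mul_eq_left]

/-- `IsMinimallyRamifiedAt` is invariant under change of frame. [folklore] -/
theorem isMinimallyRamifiedAt_conj_iff (P : GL (Fin 2) A) (ρ : FramedGaloisRep K A 2)
    (v : HeightOneSpectrum (𝓞 K)) :
    FramedGaloisRep.IsMinimallyRamifiedAt v (FramedRep.conj P ρ) ↔ ρ.IsMinimallyRamifiedAt v :=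
  forall₂_congr fun 𝔓 _ => isMinimallyRamifiedAtPrime_conj_iff P ρ 𝔓

end FramedGaloisRep

end Literature.NumberTheory.GaloisRepresentations
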